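import Summits.HodgeConjecture.HodgeConjecture.Theorems.H413E2SWBorelBoundFrameHom
import Summits.HodgeConjecture.HodgeConjecture.Theorems.H413E2SWRationalLift
import Summits.HodgeConjecture.HodgeConjecture.Theorems.H413E2SWEisStructure
import Literature.NumberTheory.Weil1965.ThetaIntegralOrbitFunctionalBound
import Literature.NumberTheory.Weil1965.ThetaIntegralHermNormSdForm
import Literature.NumberTheory.GelbartRogawski1991.Prop311RecordShapesHold
import HarnessLib

/-!
# Crux H413, E-2 child line `F0_E2SiegelWeilWeilRange`, row SW2c-BOUND: `hBOUND` FROM THE IMPLEMENTER HOM — (**)′ AT THE CM DATUM WITH EVERY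
# STRUCTURE LETTER DISCHARGED, (IMPL)+(DOM-C) READ FROM ONE EXISTENTIAL `∃ s, hs ∧ hproj ∧ hdom`

HC_CM is proved only modulo the printed citations until rung 0 closes; nothing in this file is about HC.  Cell `hodgecm-mathlib`,
floor 0, programme P4, engine E-2, item stmt-HodgeConjecture-24833 (`--supports`); seat F0P4-p07 (g3); sheet `F0/P4/SW2c-BOUND-ASSEMBLY.v1`
(8e2768b2) §B, A6c′ of its landing order (E-2 lead F0P4-p02 (g4) 06:03:39Z: consume F0P4-p05's `exists_implementerHom_CM` as written).

Sibling of ★ `Theorems/H413E2SWBorelBoundCM` (`exists_borelBound_hBOUND_of_hdom`, over ★ A6b): the SAME discharge of (INV) (★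
`E2SWRationalLift.hINV_thetaOrbitFunctional_sub_smul_adelicSiegelFunctionalC`), (Î) (★ `UnitaryDoubling.exists_thetaFrameDatum_unitary`, ★
`enorm_thetaOrbitFunctional_le`), (E_X) (★ `E2SWEisStructure.hEE_C0` ∕ `hEEmono_C0` at `C₀`) and `hsplit` for `E″ = Λ_θ − ν(univ)·E_X` at
`h = q_{C₀}` (★ `hNorm_eq_sdForm_C0`), but over ★ A6a `E2SWBorelBoundFrameHom.exists_borelBound_frame_of_hom` DIRECTLY: the implementer hom
`s : U_D → Mp` with its coefficient continuity `hs`, projection letter `hproj` and domination `hdom` enter as ONE existential per `Φ` —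
`himpl : ∀ Φ, ∃ s, hs ∧ hproj ∧ hdom` (A6a's four binders joined token for token), the conclusion shape of F0P4-p05's
`E2SWBorelBoundLettersCM.exists_implementerHom_CM` ([Weil1964] n° 41 Lemme 5 domination transported along the congruence diagonalising `T_V`).

THE THEOREM `exists_borelBound_hBOUND_of_implementerHom`: context of (T5) `E2SWIdentityCloseFibreCMFrame.hfib_CM_of_frame` (frame of record
`h2 hTW hTs u₀ hu₀ jS hjS j hj`, `E'' hE''`, `hN`, `hhN`, `hB`) + `hνX` + `himpl` ⊢ EXACTLY (T5)'s binder `hBOUND` (per `Φ`).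

References: A. Weil, Acta Math. 113 (1965), n° 41 (34)–(35) p. 59, n° 47 Lemme 20, n° 48 Lemme 21, n° 50, n° 52 [Weil1965]; A. Weil, Acta
Math. 111 (1964), Chap. I n° 13 p. 160, Chap. III n° 40–41 [Weil1964]; S. Gelbart, J. Rogawski, Invent. Math. 105 (1991), §3.1 Prop. 3.1.1
p. 455 [GelbartRogawski1991]; J.-S. Li, J. reine angew. Math. 428 (1992), p. 181 [Li1992].
-/

set_option autoImplicit false
-- the cell's `Summit.HodgeConjecture.HodgeConjecture.…` namespace repeats the summit name by design (D-0017 layout)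
set_option linter.dupNamespace false

noncomputable section

open MeasureTheory NumberField Filter Topology Set IsDedekindDomain
open scoped NNReal ENNReal Matrix
open Literature.NumberTheory.Automorphic
open Literature.NumberTheory.Weil1964 Literature.NumberTheory.Weil1965 Literature.NumberTheory.Weil1965.UnitaryDoubling
open Literature.RepresentationTheory.HeisenbergGroup
open Literature.NumberTheory.Automorphic.DoubledUnitary.RankOneReduction
open Literature.NumberTheory.Automorphic.UnitaryGroup
open Literature.NumberTheory.GelbartRogawski1991 Literature.NumberTheory.GelbartRogawski1991.UnitaryDualPair
open Summit.HodgeConjecture.HodgeConjecture.Cruxes.H413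

namespace Summit.HodgeConjecture.HodgeConjecture.Cruxes.H413.E2SWBorelBoundCMImpl

variable (F E : Type) [Field F] [NumberField F] [Field E] [NumberField E] [Algebra F E] [Algebra.IsQuadraticExtension F E]
  (c : E ≃ₐ[F] E) {δ : E} (hcδ : c δ = -δ) (hδ : δ ≠ 0) {d : F} (hd : δ * δ = algebraMap F E d)
  (N : ℕ) {n : ℕ} (e : Fin N × Fin 1 ≃ Fin n)
  (TV : Matrix (Fin N) (Fin N) F) (hV : TV.IsSymm) (hVd : IsUnit TV.det)
  (TW : Matrix (Fin 1) (Fin 1) F) (hW : TW.IsSymm) (hWd : IsUnit TW.det)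
  (hW2 : (Matrix.reindex finSumFinEquiv finSumFinEquiv (Matrix.fromBlocks TW 0 0 (-TW))).IsSymm)
  [CompactSpace (UnitaryGroup.adelic F E c N (TV.map (algebraMap F E)) ⧸ (UnitaryGroup.toAdelic F E c N (TV.map (algebraMap F E))).range)]
  [MeasurableSpace (UnitaryGroup.adelic F E c N (TV.map (algebraMap F E)) ⧸ (UnitaryGroup.toAdelic F E c N (TV.map (algebraMap F E))).range)]
  [BorelSpace (UnitaryGroup.adelic F E c N (TV.map (algebraMap F E)) ⧸ (UnitaryGroup.toAdelic F E c N (TV.map (algebraMap F E))).range)]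
  (ν : Measure (UnitaryGroup.adelic F E c N (TV.map (algebraMap F E)) ⧸ (UnitaryGroup.toAdelic F E c N (TV.map (algebraMap F E))).range))
  [IsFiniteMeasure ν]
  [MeasurableSpace (adeleQuotient F)] [BorelSpace (adeleQuotient F)]
  [MeasurableSpace (AdeleRing (𝓞 F) F)] [BorelSpace (AdeleRing (𝓞 F) F)]
  (νX : Measure (Fin (n + n) → AdeleRing (𝓞 F) F)) [νX.IsAddHaarMeasure]
  (h : (Fin (n + n) → AdeleRing (𝓞 F) F) → AdeleRing (𝓞 F) F) (hh : Continuous h)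

set_option maxHeartbeats 800000 in
/-- **`hBOUND` FROM THE IMPLEMENTER HOM** — the discharge of (INV), (Î), (E_X), `hsplit` over ★ A6a `exists_borelBound_frame_of_hom` directly: ONE hypothesis
`himpl : ∀ Φ, ∃ s, hs ∧ hproj ∧ hdom` (★ A6a's four binders joined, the shape of F0P4-p05's `E2SWBorelBoundLettersCM.exists_implementerHom_CM`)
⊢ (T5)'s `hBOUND`. [cite: Weil1965, n° 47 Lemme 20, n° 50, n° 52] [cite: Weil1965, Chap. IV n° 41, (34)–(35) p. 59]
[cite: Weil1964, Chap. I n° 13 p. 160] [cite: GelbartRogawski1991, §3.1 Prop. 3.1.1 p. 455 L1–3] -/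
theorem exists_borelBound_hBOUND_of_implementerHom [IsTotallyReal F] (hN : 2 < N)
    (hνX : νX (piFundamentalDomain F (Fin (n + n))) = 1)
    (hhN : ∀ x, h x = hNorm F E c hcδ hδ N e TV hVd TW hWd x)
    (hB : ∀ Φ ∈ piSchwartzBruhat F (Fin (n + n)), Summable fun ξ : F => ‖adelicSiegelCoeff F (Fin (n + n)) νX h Φ ξ‖)
    -- A4's frame of record (binders VERBATIM as in (T5) `hfib_CM_of_frame`)
    [IsGalois F E] (h2 : ∀ σ : E ≃ₐ[F] E, σ = 1 ∨ σ = c) (hTW : TW 0 0 ≠ 0)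
    (hTs : (adelicGram F e TV TW).IsSymm)
    (u₀ : adelicMpCont F (Fin (n + n)) (doubledGramFin F (adelicGram F e TV TW)))
    (hu₀ : ∀ Ψ : piSchwartzBruhat F (Fin (n + n)),
      ((adelicMpCont.omega F (Fin (n + n)) (doubledGramFin F (adelicGram F e TV TW)) u₀ Ψ : piSchwartzBruhat F (Fin (n + n))) :
          (Fin (n + n) → AdeleRing (𝓞 F) F) → ℂ) =
        chirp F (ratMatrix F (frameHalfRat F)) (Ψ : (Fin (n + n) → AdeleRing (𝓞 F) F) → ℂ))
    (jS : ↥(UnitaryGroup.adelic F E c (1 + 1)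
        ((Matrix.reindex finSumFinEquiv finSumFinEquiv (Matrix.fromBlocks TW 0 0 (-TW))).map (algebraMap F E))) →*
      ↥(symplecticGroup (polar (Matrix.toLinearMap₂' (AdeleRing (𝓞 F) F)
        (Matrix.fromBlocks (adelicGram F e TV TW) 0 0 (-adelicGram F e TV TW))))))
    (hjS : ∀ (A : ↥(UnitaryGroup.adelic F E c (1 + 1)
        ((Matrix.reindex finSumFinEquiv finSumFinEquiv (Matrix.fromBlocks TW 0 0 (-TW))).map (algebraMap F E))))
        (v : (Fin (n + n) → AdeleRing (𝓞 F) F) × (Fin (n + n) → AdeleRing (𝓞 F) F)),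
      ((spReindex (finSumFinEquiv : Fin n ⊕ Fin n ≃ Fin (n + n))
          (Matrix.fromBlocks (adelicGram F e TV TW) 0 0 (-adelicGram F e TV TW)) (jS A) :
          symplecticGroup (polar (Matrix.toLinearMap₂' (AdeleRing (𝓞 F) F)
            (Matrix.reindex finSumFinEquiv finSumFinEquiv
              (Matrix.fromBlocks (adelicGram F e TV TW) 0 0 (-adelicGram F e TV TW)))))) :
        ((Fin (n + n) → AdeleRing (𝓞 F) F) × (Fin (n + n) → AdeleRing (𝓞 F) F)) ≃ₗ[AdeleRing (𝓞 F) F]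
          ((Fin (n + n) → AdeleRing (𝓞 F) F) × (Fin (n + n) → AdeleRing (𝓞 F) F))) v =
      ((toSp F E c N (1 + 1)
          (((Equiv.prodCongr (Equiv.refl (Fin N)) finSumFinEquiv.symm).trans (Equiv.prodSumDistrib (Fin N) (Fin 1) (Fin 1))).trans
            ((Equiv.sumCongr e e).trans finSumFinEquiv))
          (TV.map (algebraMap F E)) ((Matrix.reindex finSumFinEquiv finSumFinEquiv (Matrix.fromBlocks TW 0 0 (-TW))).map (algebraMap F E))
          hcδ hδ hd hV hW2 rfl rfl
          (adelicInr F E c N (1 + 1) (TV.map (algebraMap F E))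
            ((Matrix.reindex finSumFinEquiv finSumFinEquiv (Matrix.fromBlocks TW 0 0 (-TW))).map (algebraMap F E)) A) :
          symplecticGroup (polar (adelicForm F (Fin (n + n))
            (adelicGram F
              (((Equiv.prodCongr (Equiv.refl (Fin N)) finSumFinEquiv.symm).trans (Equiv.prodSumDistrib (Fin N) (Fin 1) (Fin 1))).trans
                ((Equiv.sumCongr e e).trans finSumFinEquiv)) TV
              (Matrix.reindex finSumFinEquiv finSumFinEquiv (Matrix.fromBlocks TW 0 0 (-TW))))))) :
        ((Fin (n + n) → AdeleRing (𝓞 F) F) × (Fin (n + n) → AdeleRing (𝓞 F) F)) ≃ₗ[AdeleRing (𝓞 F) F]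
          ((Fin (n + n) → AdeleRing (𝓞 F) F) × (Fin (n + n) → AdeleRing (𝓞 F) F))) v)
    (j : ↥(UnitaryGroup.adelic F E c (1 + 1)
        ((Matrix.reindex finSumFinEquiv finSumFinEquiv (Matrix.fromBlocks TW 0 0 (-TW))).map (algebraMap F E))) →*
      ↥(symplecticGroup (polar (adelicForm F (Fin (n + n)) (doubledGramFin F (adelicGram F e TV TW))))))
    (hj : j = (MulAut.conj (adelicMpCont.proj F (Fin (n + n)) (doubledGramFin F (adelicGram F e TV TW)) u₀ *
        adelicMpCont.proj F (Fin (n + n)) (doubledGramFin F (adelicGram F e TV TW))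
          (doublingDeltaLift F (adelicGram F e TV TW) (isUnit_det_adelicGram F e hVd hWd)))).toMonoidHom.comp
      ((spReindex (finSumFinEquiv : Fin n ⊕ Fin n ≃ Fin (n + n))
        (Matrix.fromBlocks (adelicGram F e TV TW) 0 0 (-adelicGram F e TV TW))).comp jS))
    (E'' : piSchwartzBruhat F (Fin (n + n)) →ₗ[ℂ] ℂ)
    (hE'' : ∀ Ψ : piSchwartzBruhat F (Fin (n + n)), E'' Ψ = thetaOrbitFunctional F E c hcδ hδ hd N e TV hV hVd TW hW hWd ν Ψ -
      ((ν Set.univ).toReal : ℂ) * adelicSiegelFunctionalC F (Fin (n + n)) νX h hh hB Ψ)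
    -- (IMPL)+(DOM-C) as ONE existential per `Φ`: ★ A6a's binders `(s) (hs) (hproj) (hdom)` joined VERBATIM (F0P4-p05's `exists_implementerHom_CM`)
    (himpl : ∀ Φ : piSchwartzBruhat F (Fin (n + n)),
      ∃ s : ↥(UnitaryGroup.adelic F E c (1 + 1)
      ((Matrix.reindex finSumFinEquiv finSumFinEquiv (Matrix.fromBlocks TW 0 0 (-TW))).map (algebraMap F E))) →*
      adelicMpCont F (Fin (n + n)) (doubledGramFin F (adelicGram F e TV TW)),
        (Continuous fun A => (s A : adelicMp F (Fin (n + n)) (doubledGramFin F (adelicGram F e TV TW)))) ∧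
        (∀ (A : ↥(UnitaryGroup.adelic F E c (1 + 1)
        ((Matrix.reindex finSumFinEquiv finSumFinEquiv (Matrix.fromBlocks TW 0 0 (-TW))).map (algebraMap F E))))
        (v : (Fin (n + n) → AdeleRing (𝓞 F) F) × (Fin (n + n) → AdeleRing (𝓞 F) F)),
        ((adelicMpCont.proj F (Fin (n + n)) (doubledGramFin F (adelicGram F e TV TW)) (s A) :
        symplecticGroup (polar (adelicForm F (Fin (n + n)) (doubledGramFin F (adelicGram F e TV TW))))) :
        ((Fin (n + n) → AdeleRing (𝓞 F) F) × (Fin (n + n) → AdeleRing (𝓞 F) F)) ≃ₗ[AdeleRing (𝓞 F) F]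
        ((Fin (n + n) → AdeleRing (𝓞 F) F) × (Fin (n + n) → AdeleRing (𝓞 F) F))) v =
        ((toSp F E c N (1 + 1)
        (((Equiv.prodCongr (Equiv.refl (Fin N)) finSumFinEquiv.symm).trans (Equiv.prodSumDistrib (Fin N) (Fin 1) (Fin 1))).trans
        ((Equiv.sumCongr e e).trans finSumFinEquiv))
        (TV.map (algebraMap F E)) ((Matrix.reindex finSumFinEquiv finSumFinEquiv (Matrix.fromBlocks TW 0 0 (-TW))).map (algebraMap F E))
        hcδ hδ hd hV hW2 rfl rfl
        (adelicInr F E c N (1 + 1) (TV.map (algebraMap F E))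
        ((Matrix.reindex finSumFinEquiv finSumFinEquiv (Matrix.fromBlocks TW 0 0 (-TW))).map (algebraMap F E)) A) :
        symplecticGroup (polar (adelicForm F (Fin (n + n))
        (adelicGram F
        (((Equiv.prodCongr (Equiv.refl (Fin N)) finSumFinEquiv.symm).trans (Equiv.prodSumDistrib (Fin N) (Fin 1) (Fin 1))).trans
        ((Equiv.sumCongr e e).trans finSumFinEquiv)) TV
        (Matrix.reindex finSumFinEquiv finSumFinEquiv (Matrix.fromBlocks TW 0 0 (-TW))))))) :
        ((Fin (n + n) → AdeleRing (𝓞 F) F) × (Fin (n + n) → AdeleRing (𝓞 F) F)) ≃ₗ[AdeleRing (𝓞 F) F]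
        ((Fin (n + n) → AdeleRing (𝓞 F) F) × (Fin (n + n) → AdeleRing (𝓞 F) F))) v) ∧
        (∀ C' : Set ↥(UnitaryGroup.adelic F E c (1 + 1)
        ((Matrix.reindex finSumFinEquiv finSumFinEquiv (Matrix.fromBlocks TW 0 0 (-TW))).map (algebraMap F E))), IsCompact C' →
        ∃ Φ₀ : piSchwartzBruhat F (Fin (n + n)), ∀ A ∈ C', ∀ x,
        ‖((adelicMpCont.omega F (Fin (n + n)) (doubledGramFin F (adelicGram F e TV TW))
        (u₀ * doublingDeltaLift F (adelicGram F e TV TW) (isUnit_det_adelicGram F e hVd hWd) * s A *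
        (u₀ * doublingDeltaLift F (adelicGram F e TV TW) (isUnit_det_adelicGram F e hVd hWd))⁻¹) Φ : piSchwartzBruhat F (Fin (n + n))) :
        (Fin (n + n) → AdeleRing (𝓞 F) F) → ℂ) x‖ ≤
        (((Φ₀ : piSchwartzBruhat F (Fin (n + n))) : (Fin (n + n) → AdeleRing (𝓞 F) F) → ℂ) x).re)) :
    ∀ Φ : piSchwartzBruhat F (Fin (n + n)), ∃ Mbound : ℝ,
      ∀ (p : adelicMpCont F (Fin (n + n)) (doubledGramFin F (adelicGram F e TV TW))) (b : GL (Fin (1 + 1)) (AdeleRing (𝓞 E) E))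
        (hb : b ∈ UnitaryGroup.adelic F E c (1 + 1)
        ((Matrix.reindex finSumFinEquiv finSumFinEquiv (Matrix.fromBlocks TW 0 0 (-TW))).map (algebraMap F E))),
        (b : Matrix (Fin (1 + 1)) (Fin (1 + 1)) (AdeleRing (𝓞 E) E)) 0 0 + (b : Matrix (Fin (1 + 1)) (Fin (1 + 1)) (AdeleRing (𝓞 E) E)) 0 1 =
          (b : Matrix (Fin (1 + 1)) (Fin (1 + 1)) (AdeleRing (𝓞 E) E)) 1 0 + (b : Matrix (Fin (1 + 1)) (Fin (1 + 1)) (AdeleRing (𝓞 E) E)) 1 1 →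
        adelicMpCont.proj F (Fin (n + n)) (doubledGramFin F (adelicGram F e TV TW)) p = j ⟨b, hb⟩ →
        ‖E'' (adelicMpCont.omega F (Fin (n + n)) (doubledGramFin F (adelicGram F e TV TW)) p Φ)‖ ≤
          Mbound * Real.sqrt (adelicMpCont.l2Scaling F (doubledGramFin F (adelicGram F e TV TW))
            (isUnit_det_doubledGramFin F (adelicGram F e TV TW) (isUnit_det_adelicGram F e hVd hWd)) νX p).toReal := by
  intro Φ
  obtain ⟨sI, hsI, hprojI, hdomI⟩ := himpl Φ
  -- `n = N`, `2 < n`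
  have hNn : N = n := by simpa [Fintype.card_prod, Fintype.card_fin] using Fintype.card_congr e
  have hn : 2 < n := hNn ▸ hN
  -- `h = q_{C₀}` (★ `hNorm_eq_sdForm_C0`) and `E″ = Λ_θ − ν(univ) • E_X` as a linear map
  have hhC : h = sdForm F (Literature.NumberTheory.Weil1964.ratMatrix F (Matrix.reindex finSumFinEquiv finSumFinEquiv (Matrix.fromBlocks (gram F e TV TW) 0 0 (-(d • (gram F e TV TW)⁻¹))))) :=
    funext fun x => (hhN x).trans (UnitaryDoubling.hNorm_eq_sdForm_C0 F E c hcδ hδ hd N e TV hVd TW hWd x)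
  subst hhC
  have hE : E'' = thetaOrbitFunctional F E c hcδ hδ hd N e TV hV hVd TW hW hWd ν -
      ((ν Set.univ).toReal : ℂ) • adelicSiegelFunctionalC F (Fin (n + n)) νX
        (sdForm F (Literature.NumberTheory.Weil1964.ratMatrix F (Matrix.reindex finSumFinEquiv finSumFinEquiv (Matrix.fromBlocks (gram F e TV TW) 0 0 (-(d • (gram F e TV TW)⁻¹)))))) hh hB :=
    LinearMap.ext fun Ψ => by rw [hE'' Ψ, LinearMap.sub_apply, LinearMap.smul_apply, smul_eq_mul]
  subst hE
  -- (INV) ★ p02, on a compatible splitting of the original pair (★ [GelbartRogawski1991] Prop. 3.1.1 at `M = 1`)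
  obtain ⟨s, -, hs⟩ := compatibleSplitting_splittingDatum F E c N 1 e hcδ hδ hd hV hW hVd hWd
    (rfl : TV.map (algebraMap F E) = TV.map (algebraMap F E)) (rfl : TW.map (algebraMap F E) = TW.map (algebraMap F E))
  have hINV := E2SWRationalLift.hINV_thetaOrbitFunctional_sub_smul_adelicSiegelFunctionalC F E c hcδ hδ hd N e TV hV hVd TW hW hWd
    s hs hN ν νX hνX hB u₀ hu₀ jS hjS j hj
  -- (Î) ★ B-p10: the frame datum and the theta-side estimate
  have hfr := UnitaryDoubling.exists_thetaFrameDatum_unitary F E c hcδ hδ hd N e TV hV hVd TW hW hWd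
  obtain ⟨Ω, -, hΩ, 𝒴, h𝒴, H₀, hL⟩ := hfr
  have hI := UnitaryDoubling.enorm_thetaOrbitFunctional_le F E c hcδ hδ hd N e TV hV hVd TW hW hWd ν Ω hΩ
  -- `hsplit`: the triangle inequality
  have hsplit : ∀ Ψ : piSchwartzBruhat F (Fin (n + n)),
      (‖(thetaOrbitFunctional F E c hcδ hδ hd N e TV hV hVd TW hW hWd ν -
          ((ν Set.univ).toReal : ℂ) • adelicSiegelFunctionalC F (Fin (n + n)) νX
            (sdForm F (Literature.NumberTheory.Weil1964.ratMatrix F (Matrix.reindex finSumFinEquiv finSumFinEquiv (Matrix.fromBlocks (gram F e TV TW) 0 0 (-(d • (gram F e TV TW)⁻¹)))))) hh hB) Ψ‖ₑ : ℝ≥0∞) ≤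
        ‖thetaOrbitFunctional F E c hcδ hδ hd N e TV hV hVd TW hW hWd ν Ψ‖ₑ +
          ‖((ν Set.univ).toReal : ℂ)‖ₑ * ‖adelicSiegelFunctionalC F (Fin (n + n)) νX
            (sdForm F (Literature.NumberTheory.Weil1964.ratMatrix F (Matrix.reindex finSumFinEquiv finSumFinEquiv (Matrix.fromBlocks (gram F e TV TW) 0 0 (-(d • (gram F e TV TW)⁻¹)))))) hh hB Ψ‖ₑ := by
    intro Ψ
    rw [LinearMap.sub_apply, LinearMap.smul_apply, smul_eq_mul, ← enorm_mul]
    exact enorm_sub_le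
  exact E2SWBorelBoundFrameHom.exists_borelBound_frame_of_hom F E c hcδ hδ hd N e TW hV hW2 hVd hWd h2 hTW hTs νX _ Φ u₀ hu₀ jS hjS
    j hj hINV sI hsI hprojI hdomI (E2SWEisDecompositionCM.isSymm_C0 F e hV hW d) (E2SWEisDecompositionCM.det_C0_ne_zero F E e hVd hWd hδ hd)
    _ _ _ enorm_ne_top hsplit Ω _ (ν Set.univ) (measure_ne_top ν _) hI h𝒴 hL (E2SWEisStructure.hEE_C0 F e d νX hB)
    (fun Ψ Ψ' hle => E2SWEisStructure.hEEmono_C0 F E e hV hW hVd hWd hδ hd hN νX hB Ψ Ψ' hle) hn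

end Summit.HodgeConjecture.HodgeConjecture.Cruxes.H413.E2SWBorelBoundCMImpl

end
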